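import Literature.IUT.HodgeTheaters.FrobenioidBridgeModels
import Literature.IUT.HodgeTheaters.BaseThetaDatumModel
import HarnessLib

/-!
# [IUTchI] Example 5.4 (vi) as typed over the stub `S5Local` is a SCHEMA: kernel evidence (proof-only companion)

Mochizuki, *Inter-universal Teichmüller theory I*, §5, Example 5.4 (vi), kurims May-2020 manuscript p. 149 l. 62 –
p. 150 l. 6: "any poly-morphism `†ℱ_⟨J⟩ → †ℱ^⊚` induces, via restriction, an isomorphism class of functors
`(†ℱ^⊚ → †ℱ^⊛ ⊇) †ℱ^⊛_mod ⥲ †ℱ^⊛_⟨J⟩ → †ℱ_{v⟨J⟩}` … which is independent of the choice of the poly-morphism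
`†ℱ_⟨J⟩ → †ℱ^⊚` [i.e., among its `F_l^⋇`-conjugates]. That is to say, the fact that `†ℱ^⊛_mod` is defined in terms of
terminal objects of `†𝒟^⊛` … implies that this particular isomorphism class of functors is immune to [i.e., fixed
by] the various indeterminacies that appear in the choice of `†ℱ_⟨J⟩ → †ℱ^⊚`."

The statement file `FrobenioidBridgeModels.lean` (abc-iut-L5-t3, FROZEN) renders this over the local hypothesis
structure `S5Local 𝔡`, whose field `restrictionOf : DashArrow Y Z → (X : ℱ-prime-strip) → LabCusp(𝒟^⊚(Y)) →
RestrictionDatum Z X` is BARE DATA carrying no law, as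
`S5Local.Ex54vi S : ∀ Y Z d X δ δ', S.restrictionOf d X δ = S.restrictionOf d X δ'`.
This proof-only file records, for the D-0067 adjudication (plan/FACT-LIST.md row F-2000, node `IUTchI:Ex5.4(vi)`):

* `S5Local.ex54vi_of_subsingleton` — `Ex54vi S` holds for every stub whose restriction data are subsingletons
  (in particular for the KIT witness `toyS5Local` of abc-iut-L5-t3, `RestrictionDatum := PUnit`);
* `BaseThetaDatum.exists_s5Local_ex54vi` / `BaseThetaDatum.exists_s5Local_not_ex54vi` — over the consistency model
  `BaseThetaDatum.trivialModel` (`l = 5`) there are inhabitants of `S5Local` in which `Ex54vi` HOLDS, resp. FAILS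
  (take `RestrictionDatum := F_5^⋇` and `restrictionOf d X δ := δ`; `F_5^⋇` has two elements);
* hence `S5Local.ex54vi_independent` — `Ex54vi` is neither provable nor refutable from the interface `S5Local`:
  AS TYPED it is a SCHEMA (true exactly in the models whose `restrictionOf` ignores its `δ`-argument), not a
  statement about the printed objects. Print's reason lives in the CONSTRUCTION of the restriction functors
  (Example 5.1 (iii)/(vii): `†ℱ^⊛_mod` via terminal objects of `†𝒟^⊛`), which the kit abstracts into the very
  argument `δ` that print says the construction does not use.

Disposition recorded for the planner / typer-successor (UNPROVABLE-AS-TYPED, L5-lead ruling 2026-08-25T23:21:23Z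
(C)): either the `…R` repair "`restrictionOf` without the `δ`-argument" (then (vi) is definitional), or the merge
lemma identifying `S.restrictionOf` with the Example 5.1 (vii) restriction functors of `GlobalFrobenioids*.lean`
(row `FrobenioidBridgeModelsAdapter`, abc-iut-L5-t1). Nothing is added to or removed from the frozen statement file.
Record-only; [claim: Mochizuki2012, status: disputed]; nothing here takes a side on [IUTchIII] Cor. 3.12 — the
refuted/verified object is OUR transcription over OUR stub, not a statement of print.
-/

namespace Literature.IUT.HodgeTheaters

open CategoryTheory

universe u

namespace BaseThetaDatum

namespace S5Local

variable {𝔡 : BaseThetaDatum.{u}} (S : S5Local 𝔡)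

/-- [IUTchI] Ex. 5.4 (vi) over the stub: if every type of restriction data `S.RestrictionDatum Z X` is a
subsingleton, then `Ex54vi S` holds (trivially — this is the case of abc-iut-L5-t3's KIT witness `toyS5Local`,
where `RestrictionDatum := PUnit`). [claim: Mochizuki2012, status: disputed] -/
theorem ex54vi_of_subsingleton (h : ∀ (Z : S.FAmbGlob) (X : S.FPrimeStrip), Subsingleton (S.RestrictionDatum Z X)) :
    Ex54vi S :=
  fun _ Z _ X _ _ => (h Z X).elim _ _

/-- [IUTchI] Ex. 5.4 (vi) over the stub, sufficient form: if each `S.restrictionOf d X` factors through a datum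
not involving `δ` — which is how print CONSTRUCTS the restriction functors (Ex. 5.1 (vii): from `†ℱ^⊛_mod`, i.e.
terminal objects of `†𝒟^⊛`, and `v⟨J⟩`) — then `Ex54vi S` holds. [claim: Mochizuki2012, status: disputed] -/
theorem ex54vi_of_exists_const
    (h : ∀ (Y : S.FAmbG) (Z : S.FAmbGlob) (d : S.DashArrow Y Z) (X : S.FPrimeStrip),
      ∃ r : S.RestrictionDatum Z X, ∀ δ : FPolyHomNF S X Y, S.restrictionOf d X δ = r) :
    Ex54vi S := by
  intro Y Z d X δ δ'
  obtain ⟨r, hr⟩ := h Y Z d X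
  rw [hr δ, hr δ']

end S5Local

open TrivialModel

/-- Over the consistency model `trivialModel` (`l = 5`, one bad place, one-object ambient categories) there is an
inhabitant of the §5 stub `S5Local` in which [IUTchI] Ex. 5.4 (vi) AS TYPED holds: all `ℱ`-level data trivial,
`RestrictionDatum := PUnit` (the KIT witness shape of abc-iut-L5-t3, rebuilt inline so that this file stays
proof-only). [claim: Mochizuki2012, status: disputed] -/
theorem exists_s5Local_ex54vi : ∃ S : S5Local trivialModel, S5Local.Ex54vi S := by
  refine ⟨{ FAmb := fun _ => LocAmb
            F := fun _ => SingleObj.star _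
            nonempty_isoF := fun _ _ _ => ⟨Iso.refl _⟩
            base := fun _ => 𝟭 _
            FAmbG := GlobAmb
            FG := SingleObj.star _
            nonempty_isoFG := fun _ _ => ⟨Iso.refl _⟩
            baseG := fun Y => Y
            baseGIso := fun b => b
            baseGIso_refl := fun _ => rfl
            baseGIso_trans := fun _ _ => rfl
            FAmbGlob := GlobAmb
            FGlob := SingleObj.star _
            nonempty_isoFGlob := fun _ _ => ⟨Iso.refl _⟩
            DashArrow := fun _ _ => PUnit
            dashModel := PUnit.unit
            restrictAt := fun _ _ _ => SingleObj.star _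
            ThetaHT := GlobAmb
            HT := SingleObj.star _
            nonempty_isoHT := fun _ _ => ⟨Iso.refl _⟩
            assocStrip := fun _ _ => SingleObj.star _
            assocStripIso := fun _ _ => Iso.refl _
            valOfNF := fun _ => ()
            valOfNF_postNF := fun _ _ => rfl
            valOfNF_preNF := fun _ _ => rfl
            valOfNF_phiNF := fun _ => rfl
            RestrictionDatum := fun _ _ => PUnit
            restrictionOf := fun _ _ _ => PUnit.unit }, ?_⟩
  exact S5Local.ex54vi_of_subsingleton _ fun _ _ => inferInstance

/-- Over the same model there is an inhabitant of `S5Local` in which [IUTchI] Ex. 5.4 (vi) AS TYPED FAILS: take the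
restriction data to be the label itself, `RestrictionDatum := F_5^⋇`, `restrictionOf d X δ := δ` — the stub imposes
no law on `restrictionOf`, and `F_5^⋇` has `l^⋇ = 2` elements. [claim: Mochizuki2012, status: disputed] -/
theorem exists_s5Local_not_ex54vi : ∃ S : S5Local trivialModel, ¬ S5Local.Ex54vi S := by
  refine ⟨{ FAmb := fun _ => LocAmb
            F := fun _ => SingleObj.star _
            nonempty_isoF := fun _ _ _ => ⟨Iso.refl _⟩
            base := fun _ => 𝟭 _
            FAmbG := GlobAmb
            FG := SingleObj.star _
            nonempty_isoFG := fun _ _ => ⟨Iso.refl _⟩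
            baseG := fun Y => Y
            baseGIso := fun b => b
            baseGIso_refl := fun _ => rfl
            baseGIso_trans := fun _ _ => rfl
            FAmbGlob := GlobAmb
            FGlob := SingleObj.star _
            nonempty_isoFGlob := fun _ _ => ⟨Iso.refl _⟩
            DashArrow := fun _ _ => PUnit
            dashModel := PUnit.unit
            restrictAt := fun _ _ _ => SingleObj.star _
            ThetaHT := GlobAmb
            HT := SingleObj.star _
            nonempty_isoHT := fun _ _ => ⟨Iso.refl _⟩
            assocStrip := fun _ _ => SingleObj.star _
            assocStripIso := fun _ _ => Iso.refl _
            valOfNF := fun _ => ()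
            valOfNF_postNF := fun _ _ => rfl
            valOfNF_preNF := fun _ _ => rfl
            valOfNF_phiNF := fun _ => rfl
            RestrictionDatum := fun _ _ => FlStar 5
            restrictionOf := fun _ _ δ => δ }, ?_⟩
  intro h
  have hcard : Nat.card (FlStar 5) = 2 := by
    rw [card_flStar 5 (by decide)]; rfl
  haveI : Finite (FlStar 5) := Nat.finite_of_card_ne_zero (by omega)
  obtain ⟨a, b, hab⟩ := (Finite.one_lt_card_iff_nontrivial.mp (by omega : 1 < Nat.card (FlStar 5))).exists_pair_ne
  exact hab (h (SingleObj.star (FlStar 5)) (SingleObj.star (FlStar 5)) PUnit.unit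
    (fun _ => SingleObj.star (Multiplicative ℕ)) a b)

/-- **[IUTchI] Ex. 5.4 (vi) AS TYPED is independent of the interface `S5Local`** (UNPROVABLE-AS-TYPED, and not
refutable either): over one and the same base datum it holds in one inhabitant of the stub and fails in another.
Consequently node `IUTchI:Ex5.4(vi)` cannot be discharged (nor refuted) by any proof over the kit; its content is
carried by the CONSTRUCTION of the restriction functors (Ex. 5.1 (iii)/(vii), terminal objects of `†𝒟^⊛`), to be
supplied by the merge/repair recorded in the module docstring. [claim: Mochizuki2012, status: disputed] -/
theorem S5Local.ex54vi_independent :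
    (∃ S : S5Local trivialModel, S5Local.Ex54vi S) ∧ (∃ S : S5Local trivialModel, ¬ S5Local.Ex54vi S) :=
  ⟨exists_s5Local_ex54vi, exists_s5Local_not_ex54vi⟩

/-- In particular the universally quantified form "`Ex54vi` for EVERY stub over EVERY base datum" is FALSE — the
one-object refutation asked for by the L5 lead (ruling 2026-08-25T23:21:23Z (C)). [claim: Mochizuki2012, status: disputed] -/
theorem S5Local.not_forall_ex54vi :
    ¬ ∀ (𝔡 : BaseThetaDatum.{0}) (S : S5Local 𝔡), S5Local.Ex54vi S := by
  intro h
  obtain ⟨S, hS⟩ := exists_s5Local_not_ex54vi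
  exact hS (h trivialModel S)

end BaseThetaDatum

end Literature.IUT.HodgeTheaters
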